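import Literature.Probability.Percolation.BoxCrossingIteration
import Literature.Probability.Percolation.DiagonalBoxCrossing
import HarnessLib

/-!
# Box crossings of isoradial square lattices: the iteration of Corollary 6.2 — II. The steps

Grimmett–Manolescu, *Bond percolation on isoradial graphs* (PTRF 159 (2014) 273–327 =
arXiv:1204.0505), §6.1–§6.2. In the vocabulary of `BoxCrossingIteration` this file proves:

* `base_lrLower`, `base_tbLower` — **the base case**: uniform bounds for the class
  `baseC = {(c·1, (c+π/2)·1)}` of rotated copies of `ℤ²` (`P = P_{1/2}`; `DiagonalBoxCrossing`);
* `lrLower_of_hTransport` — **Proposition 6.1, horizontal half**: given the conclusion of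
  Proposition 6.4 (as a hypothesis, in the exact form of `HorizontalTransportHonest.horizontal_transport`)
  and uniform bounds for a source class `Cs` (`C_h` of all aspect ratios, `C_v` of squares), every
  shift-invariant target class `Ct` whose members `(α, β)` have a source `(α, ξ·1) ∈ Cs` with
  `ξ - α_i, β_j - α_i ∈ [ε, π - ε]` has uniform bounds for left–right crossings of every aspect
  ratio ((6.12) `prod_three_le_measureReal_initEventGM`, the dictionary
  `finalEventGM_subset_embRectCrossing`, monotonicity in the box and translation covariance).

## References

* G. R. Grimmett, I. Manolescu, PTRF 159 (2014), arXiv:1204.0505, §6.1 (Prop. 6.1), §6.2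
  (Prop. 6.4, (6.12), proof of Cor. 6.2).
-/

noncomputable section

namespace Literature.Probability.Percolation

open LatticeModels StarTriangle Real MeasureTheory Complex

namespace TrackExchange

/-! ### The base class -/

/-- The rotated square lattices `G_{c, c+π/2}` (all the same measure `P_{1/2}`). [cite: GrimmettManolescu2014Isoradial, §6.2 (proof of Cor. 6.2: "the homogeneous square lattice")] -/
def baseC : Set ((ℤ → ℝ) × (ℤ → ℝ)) := {p | ∃ c : ℝ, p = (fun _ => c, fun _ => c + π / 2)}

/-- `P_{c, c+π/2} = P_{1/2}` = the canonical measure of `squareLatticeEmbedding`. [cite: GrimmettManolescu2014Isoradial, §4.3.1] -/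
theorem Pgm_base (c : ℝ) : Pgm (fun _ => c) (fun _ => c + π / 2) = squareLatticeEmbedding.isoradialPercolation := by
  rw [← gmEmbedding_squareLattice, isoradialPercolation_gmEmbedding (fun i j => by constructor <;> linarith [Real.pi_pos])]
  unfold Pgm
  rw [← gmWeight_add_const (fun _ => -(π / 4)) (fun _ => π / 4) (c + π / 4)]
  congr 2 <;> funext i <;> ring

/-- **Base case, left–right.** [cite: GrimmettManolescu2014Isoradial, §6.2 (the square lattice has the box-crossing property)] -/
theorem base_lrLower : (lrLower baseC 2).Nonempty := by
  obtain ⟨c, hc, m₀, h⟩ := diag_lr_lower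
  refine ⟨(c, m₀), hc, ?_⟩
  rintro p ⟨c', rfl⟩ n hn A B
  simp only
  rw [Pgm_base]
  simpa [lrEvt] using h n hn A B

/-- **Base case, top–bottom.** [cite: GrimmettManolescu2014Isoradial, §6.2 (the square lattice has the box-crossing property)] -/
theorem base_tbLower : (tbLower baseC 2).Nonempty := by
  obtain ⟨c, hc, m₀, h⟩ := diag_tb_lower
  refine ⟨(c, m₀), hc, ?_⟩
  rintro p ⟨c', rfl⟩ n hn A B
  simp only
  rw [Pgm_base]
  simpa [tbEvt] using h n hn A B

/-! ### The events of (6.12) as index-box events -/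

/-- `C_h[B(ρN, N)]` as an `lrEvt`. [folklore] -/
theorem chBox_eq_lrEvt (ρ N : ℕ) : chBox ρ N = lrEvt (-((ρ * N : ℕ) : ℤ)) 0 (2 * (ρ * N)) N := by
  unfold chBox lrEvt; congr 1
  · funext v; push_cast; ring
  · push_cast; ring

/-- `C_v` of the left end square as a `tbEvt`. [folklore] -/
theorem cvLeft_eq_tbEvt (ρ N : ℕ) : cvLeft ρ N = tbEvt (-((ρ * N : ℕ) : ℤ)) 0 N N := by
  unfold cvLeft tbEvt; congr 1
  funext v; push_cast; ring

/-- `C_v` of the right end square as a `tbEvt`. [folklore] -/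
theorem cvRight_eq_tbEvt (ρ N : ℕ) : cvRight ρ N = tbEvt (((ρ - 1) * N : ℕ) : ℤ) 0 N N := by
  unfold cvRight tbEvt; congr 1
  funext v; push_cast; ring

/-- The target of Prop. 6.4 inside an `lrEvt`. [folklore] -/
theorem finalEventGM_subset_lrEvt (ρ N K : ℕ) {ω : Set (Sym2 (Site 2))} (hω : ω ⊆ (zdGraph 2).edgeSet)
    (h : ω ∈ finalEventGM ρ N K) : ω ∈ lrEvt (-(((ρ - 1) * N : ℕ) : ℤ)) 0 (2 * ((ρ - 1) * N)) K := by
  have := finalEventGM_subset_embRectCrossing ρ N K hω h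
  unfold lrEvt
  convert this using 2
  · funext v; push_cast; ring
  · push_cast; ring

/-! ### Translation to an arbitrary position -/

/-- **Bounds at two adjacent base positions give bounds everywhere** (translation covariance and
parity). [folklore] -/
theorem lr_bound_everywhere {Ct : Set ((ℤ → ℝ) × (ℤ → ℝ))}
    (hshift : ∀ p ∈ Ct, ∀ s t : ℤ, ((fun i => p.1 (i - s)), (fun j => p.2 (j - t))) ∈ Ct)
    {c : ℝ} {A₀ : ℤ} {a b : ℕ}
    (h : ∀ p ∈ Ct, c ≤ (Pgm p.1 p.2).real (lrEvt A₀ 0 a b) ∧ c ≤ (Pgm p.1 p.2).real (lrEvt (A₀ + 1) 0 a b))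
    (p : (ℤ → ℝ) × (ℤ → ℝ)) (hp : p ∈ Ct) (A B : ℤ) : c ≤ (Pgm p.1 p.2).real (lrEvt A B a b) := by
  -- the translation vector `t` with `hgt t = -B` and `col t ∈ {A₀ - A, A₀ + 1 - A}` of the parity of `B`
  obtain ⟨k, hk⟩ : ∃ k : ℤ, (A₀ - A - B = 2 * k) ∨ (A₀ + 1 - A - B = 2 * k) := by
    rcases Int.even_or_odd (A₀ - A - B) with ⟨k, hk⟩ | ⟨k, hk⟩
    · exact ⟨k, Or.inl (by omega)⟩
    · exact ⟨k + 1, Or.inr (by omega)⟩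
  rcases hk with hk | hk
  · -- col t = A₀ - A
    set t : Site 2 := ![k, -k - B] with ht
    have hct : col t = A₀ - A := by simp [col, ht]; omega
    have hht : hgtOf t = -B := by simp [hgtOf, ht]; ring
    have key := (h _ (hshift p hp (col t) (hgtOf t))).1
    rw [lrEvt, measureReal_embRectCrossing_shift p.1 p.2 t]
    convert key using 3
    unfold lrEvt; congr 1; funext v
    simp only [zDia, hct, hht]; push_cast; ring
  · set t : Site 2 := ![k, -k - B] with ht
    have hct : col t = A₀ + 1 - A := by simp [col, ht]; omega
    have hht : hgtOf t = -B := by simp [hgtOf, ht]; ring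
    have key := (h _ (hshift p hp (col t) (hgtOf t))).2
    rw [lrEvt, measureReal_embRectCrossing_shift p.1 p.2 t]
    convert key using 3
    unfold lrEvt; congr 1; funext v
    simp only [zDia, hct, hht]; push_cast; ring

/-! ### Proposition 6.1, horizontal half -/

/-- `ρ e^{-N} ≤ 1/2` for `N ≥ 2ρ`. [folklore] -/
theorem rho_mul_exp_neg_le {ρ N : ℕ} (hN : 2 * ρ ≤ N) : (ρ : ℝ) * Real.exp (-N) ≤ 1 / 2 := by
  rcases Nat.eq_zero_or_pos ρ with h0 | h0
  · subst h0; simp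
  have h1 : Real.exp (-(N : ℝ)) ≤ Real.exp (-(2 * ρ : ℝ)) := Real.exp_le_exp.2 (by
    have : (2 * ρ : ℝ) ≤ N := by exact_mod_cast hN
    linarith)
  have h2 : (1 : ℝ) + 2 * ρ ≤ Real.exp (2 * ρ) := by
    have := Real.add_one_le_exp (2 * ρ : ℝ); linarith
  have h3 : Real.exp (-(2 * ρ : ℝ)) = 1 / Real.exp (2 * ρ) := by rw [Real.exp_neg, one_div]
  have hρ : (0 : ℝ) < ρ := by exact_mod_cast h0
  calc (ρ : ℝ) * Real.exp (-N) ≤ ρ * Real.exp (-(2 * ρ : ℝ)) := mul_le_mul_of_nonneg_left h1 hρ.le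
    _ = ρ / Real.exp (2 * ρ) := by rw [h3]; ring
    _ ≤ ρ / (1 + 2 * ρ) := div_le_div_of_nonneg_left hρ.le (by positivity) h2
    _ ≤ 1 / 2 := by rw [div_le_iff₀ (by positivity)]; linarith

/-- **Proposition 6.1 (horizontal half), from Proposition 6.4.** Let `0 < ε ≤ π/2`, and assume the
conclusion of Prop. 6.4 (`hT`). Let `Cs`, `Ct` be classes of lattices such that every
`(α, β) ∈ Ct` has a source `(α, ξ·1) ∈ Cs` with `ξ - α_i, β_j - α_i ∈ [ε, π - ε]`, `Ct` is shift
invariant, and `Cs` has uniform lower bounds for left–right crossings of every aspect ratio and for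
top–bottom crossings of squares. Then `Ct` has uniform lower bounds for left–right crossings of
every aspect ratio. [cite: GrimmettManolescu2014Isoradial, §6.1 Prop. 6.1 with §6.2 (6.12)–(6.14)] -/
theorem lrLower_of_hTransport {ε : ℝ}
    (hT : ∃ lam N₀ : ℕ, 1 ≤ lam ∧ 1 ≤ N₀ ∧ ∀ (ρ N : ℕ), 1 ≤ ρ → N₀ ≤ N → ∀ (α β : ℤ → ℝ) (ξ : ℝ),
      AnglesIn ε α (fun _ => ξ) → AnglesIn ε α β →
      (1 - ρ * Real.exp (-N)) * (prodBernoulli (Percolation.gmWeight α fun _ => ξ)).real (initEventGM ρ N) ≤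
        (prodBernoulli (Percolation.gmWeight α β)).real (finalEventGM ρ N (lam * N)))
    {Cs Ct : Set ((ℤ → ℝ) × (ℤ → ℝ))}
    (hsrc : ∀ p ∈ Ct, ∃ ξ : ℝ, (p.1, fun _ => ξ) ∈ Cs ∧ AnglesIn ε p.1 (fun _ => ξ) ∧ AnglesIn ε p.1 p.2)
    (hshift : ∀ p ∈ Ct, ∀ s t : ℤ, ((fun i => p.1 (i - s)), (fun j => p.2 (j - t))) ∈ Ct)
    (hH : ∀ ρ, 1 ≤ ρ → (lrLower Cs ρ).Nonempty) (hV : (tbLower Cs 1).Nonempty) {ρ' : ℕ} (hρ' : 1 ≤ ρ') :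
    (lrLower Ct ρ').Nonempty := by
  obtain ⟨lam, N₀, hlam, hN₀, hT⟩ := hT
  set ρ : ℕ := lam * ρ' + 2 with hρ
  have hρ1 : 1 ≤ ρ := by omega
  obtain ⟨⟨cH, nH⟩, hcH, hHb⟩ := hH (2 * ρ) (by omega)
  obtain ⟨⟨cV, nV⟩, hcV, hVb⟩ := hV
  simp only at hcH hHb hcV hVb
  set N₁ : ℕ := max (max N₀ (2 * ρ)) (max nH nV) with hN₁
  set c : ℝ := cH * cV * cV / 2 with hc
  refine ⟨(c, lam * (N₁ + 1)), by positivity, ?_⟩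
  -- the bound at the two base positions
  have base : ∀ n : ℕ, lam * (N₁ + 1) ≤ n → ∀ p ∈ Ct, ∀ A₀' : ℤ, A₀' = -(((ρ - 1) * (n / lam) : ℕ) : ℤ) ∨ A₀' = -(((ρ - 1) * (n / lam) : ℕ) : ℤ) + 1 →
      c ≤ (Pgm p.1 p.2).real (lrEvt A₀' 0 (ρ' * n) n) := by
    intro n hn p hp A₀' hA₀'
    set N : ℕ := n / lam with hN
    have hlam0 : 0 < lam := hlam
    have hNge : N₁ + 1 ≤ N := by rw [hN]; exact (Nat.le_div_iff_mul_le hlam0).2 (by rw [mul_comm]; exact hn)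
    have hN0 : N₀ ≤ N := by omega
    have hNρ : 2 * ρ ≤ N := by omega
    have hNH : nH ≤ N := by omega
    have hNV : nV ≤ N := by omega
    have hN1 : 1 ≤ N := by omega
    have hKn : lam * N ≤ n := by rw [hN, mul_comm]; exact Nat.div_mul_le_self n lam
    have hnK : n < lam * (N + 1) := by
      have h1 : lam * N + n % lam = n := by rw [hN]; exact Nat.div_add_mod n lam
      have h2 : n % lam < lam := Nat.mod_lt n hlam0
      rw [Nat.mul_succ]; omega
    -- the width bookkeeping: `ρ' n + 1 ≤ 2 (ρ - 1) N`
    have hM : ρ - 1 = lam * ρ' + 1 := by rw [hρ]; omega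
    have hwidth : ρ' * n + 1 ≤ 2 * ((ρ - 1) * N) := by
      rw [hM]
      have h1 : ρ' * (n + 1) ≤ ρ' * (lam * (N + 1)) := Nat.mul_le_mul_left ρ' hnK
      have h2 : 1 ≤ N := hN1
      nlinarith [h1, h2, hρ']
    -- the source lattice and the transport
    obtain ⟨ξ, hs, hξ, hβ⟩ := hsrc p hp
    have htr := hT ρ N hρ1 hN0 p.1 p.2 ξ hξ hβ
    have h612 := prod_three_le_measureReal_initEventGM p.1 (fun _ => ξ) hρ1 hN1
    have b1 : cH ≤ (Pgm p.1 fun _ => ξ).real (chBox ρ N) := by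
      have := hHb (p.1, fun _ => ξ) hs N hNH (-((ρ * N : ℕ) : ℤ)) 0
      rw [chBox_eq_lrEvt, show 2 * (ρ * N) = 2 * ρ * N by ring]; exact this
    have b2 : cV ≤ (Pgm p.1 fun _ => ξ).real (cvLeft ρ N) := by
      have := hVb (p.1, fun _ => ξ) hs N hNV (-((ρ * N : ℕ) : ℤ)) 0
      rw [cvLeft_eq_tbEvt]; simpa using this
    have b3 : cV ≤ (Pgm p.1 fun _ => ξ).real (cvRight ρ N) := by
      have := hVb (p.1, fun _ => ξ) hs N hNV (((ρ - 1) * N : ℕ) : ℤ) 0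
      rw [cvRight_eq_tbEvt]; simpa using this
    have hhalf : (1 : ℝ) / 2 ≤ 1 - ρ * Real.exp (-N) := by have := rho_mul_exp_neg_le hNρ; linarith
    have step1 : c ≤ (Pgm p.1 p.2).real (finalEventGM ρ N (lam * N)) := by
      calc c = 1 / 2 * (cH * cV * cV) := by rw [hc]; ring
        _ ≤ (1 - ρ * Real.exp (-N)) * ((Pgm p.1 fun _ => ξ).real (chBox ρ N) * (Pgm p.1 fun _ => ξ).real (cvLeft ρ N) *
              (Pgm p.1 fun _ => ξ).real (cvRight ρ N)) := by gcongr
        _ ≤ (1 - ρ * Real.exp (-N)) * (Pgm p.1 fun _ => ξ).real (initEventGM ρ N) :=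
              mul_le_mul_of_nonneg_left h612 (by linarith)
        _ ≤ _ := htr
    -- from the target event to the box at the base position
    refine step1.trans (measureReal_le_of_subset_ae p.1 p.2 fun ω hω h => ?_)
    have h1 := finalEventGM_subset_lrEvt ρ N (lam * N) hω h
    have h2 : ω ∈ lrEvt A₀' 0 (ρ' * n) (lam * N) := by
      refine lrEvt_anti_width ?_ ?_ hω h1
      · rcases hA₀' with rfl | rfl <;> omega
      · have : ((ρ' * n : ℕ) : ℤ) + 1 ≤ 2 * (((ρ - 1) * N : ℕ) : ℤ) := by exact_mod_cast hwidth
        rcases hA₀' with rfl | rfl <;> push_cast at this ⊢ <;> linarith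
    exact lrEvt_mono_height (le_refl _) (by rw [zero_add, zero_add]; exact_mod_cast hKn) h2
  intro p hp n hn A B
  exact lr_bound_everywhere hshift (fun q hq => ⟨base n hn q hq _ (Or.inl rfl), base n hn q hq _ (Or.inr rfl)⟩) p hp A B

end TrackExchange

end Literature.Probability.Percolation
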